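import Summits.AtomisticToContinuum.HydrodynamicLimit.Theorems.JParityClosureOddContactSymmetryHardCoreMarginals
import Summits.AtomisticToContinuum.HydrodynamicLimit.Theorems.AntiMazurCoboundariesInfluenceLocalityTightChainPressureNecklace
import Summits.AtomisticToContinuum.HydrodynamicLimit.Theorems.AntiMazurCoboundariesInfluenceLocalityTightChainPressurePrelim

/-!
# Disjoint close pairs are exponentially unlikely under the homogeneous hard-sphere Gibbs law

Route `AntiMazurCoboundaries` of `AtomisticToContinuum/HydrodynamicLimit`, crux stmt-AtomisticToContinuum-14135
(`CorrectorPressureDecay`), line `almost-invariant-duality`, lead-held layer-2 input h₂ = within-lag SHOT-NOISE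
PRESSURE (hypothesis `h₂` of `TransferSkeleton.correctorPressureDecay_of_inputs`); registered sub-goal `snp_pairsBound`.

Under `G_N = localGibbsLaw σ a u₀ θ N Φ` (constant profiles, `0 < σ ≤ 1/4`), for `m` pairs `(p k, q k)` of
spheres with `p` injective and the ranges of `p`, `q` disjoint, and a relative shell width `0 < lam ≤ 1`, the
probability that every pair is within minimal-image distance `ε_N (1 + lam)` (`ε_N = hsDiameter σ N`) is at most
`(200 σ³ lam / (N+1))^m`:
* the event is a position event, so its `G_N`-probability is its probability under the configurational Gibbs
  measure `posGibbsMeasure` (`localGibbsMeasure_preimage_pos`);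
* the hard core holds almost surely (`posGibbsMeasure_inter_posDomain`), so each pair displacement
  `x (p k) - x (q k)` lies in the thin shell `T = {u | ε_N ≤ d(u, 0) ≤ ε_N (1 + lam)}`;
* the shell event depends on the `≤ 2m` coordinates of `im p ∪ im q`, so the hard-core marginal (Ruelle) bound
  `posGibbsMeasure_marginal_le` bounds it by `4^m` times its product-Haar measure, which is `(vol T)^m`
  (`pi_pairsEvent_eq`: integrate out `x (p 0)`, `x (p 1)`, … by translation invariance,
  `TrueAnchoredInfection.pi_inter_pairEvent_eq`);
* `vol T ≤ v₁ ((1+lam)³ − 1) ε_N³ ≤ (16/3) · 7 lam · σ³/(N+1)` (`TrueAnchoredInfection.volume_shell_le`,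
  `v₁ = 4π/3 ≤ 16/3`, `(N+1) ε_N³ = σ³`), and `4 · (16/3) · 7 ≤ 200`.
-/

noncomputable section

open MeasureTheory Set Filter Topology
open scoped ENNReal Classical

namespace Summit.AtomisticToContinuum.HydrodynamicLimit.Theorems.ShotNoisePressure

open Literature.Analysis.FluidPDE
open Literature.MathematicalPhysics.KineticTheory (T3 V3 hsDiameter localGibbsLaw gaussMeasure)

open Literature.MathematicalPhysics.KineticTheory in
/-- The volume of the unit ball of `ℝ³` is at most `16/3` (`v₁ = 4π/3`, `π ≤ 4`). [folklore] -/
theorem v₁_le : v₁ ≤ 16 / 3 := by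
  unfold v₁
  rw [EuclideanSpace.volume_ball_fin_three, ENNReal.ofReal_one, one_pow, one_mul,
    ENNReal.toReal_ofReal (by positivity)]
  nlinarith [Real.pi_le_four]

open Literature.MathematicalPhysics.KineticTheory in
/-- The configurational Gibbs measure does not charge overlapping configurations: intersecting with the
non-overlap set does not change probabilities (the density carries its indicator). [folklore] -/
theorem posGibbsMeasure_inter_posDomain (a₀ : T3 → ℝ) (ε : ℝ) (n : ℕ) (S : Set (Fin n → T3)) :
    posGibbsMeasure a₀ ε n (S ∩ posDomain ε n) = posGibbsMeasure a₀ ε n S := by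
  refine measure_inter_conull ?_
  have hDc := (measurableSet_posDomain ε n).compl
  rw [posGibbsMeasure, withDensity_apply _ hDc]
  have h0 : ∫⁻ x in (posDomain ε n)ᶜ, ENNReal.ofReal ((posPartition a₀ ε n)⁻¹ * posWeight a₀ ε n x) =
      ∫⁻ _ in (posDomain ε n)ᶜ, (0 : ℝ≥0∞) :=
    setLIntegral_congr_fun hDc fun x hx => by
      rw [posWeight, indicator_of_notMem hx, mul_zero, ENNReal.ofReal_zero]
  rw [h0, lintegral_zero]

/-- The disjoint-pairs displacement event `{x | ∀ k, x (p k) - x (q k) ∈ T}` is measurable. [folklore] -/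
theorem measurableSet_pairsEvent {n m : ℕ} (p q : Fin m → Fin n) {T : Set T3} (hT : MeasurableSet T) :
    MeasurableSet {x : Fin n → T3 | ∀ k : Fin m, x (p k) - x (q k) ∈ T} := by
  rw [Set.setOf_forall]
  exact MeasurableSet.iInter fun k => Literature.MathematicalPhysics.KineticTheory.measurableSet_pairEvent _ _ hT

/-- **Product Haar measure of the disjoint-pairs event.** For `p` injective with range disjoint from that of
`q` and a measurable `T ⊆ 𝕋³`, `ℙ^{⊗}{∀ k, x (p k) − x (q k) ∈ T} = (vol T)^m` (integrate out the coordinate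
`x (p 0)`, on which the remaining pairs do not depend, by translation invariance, and recurse). [folklore] -/
theorem pi_pairsEvent_eq {n : ℕ} {T : Set T3} (hT : MeasurableSet T) :
    ∀ {m : ℕ} (p q : Fin m → Fin n), Function.Injective p → (∀ k k', p k ≠ q k') →
      (Measure.pi fun _ : Fin n => (volume : Measure T3))
        {x : Fin n → T3 | ∀ k : Fin m, x (p k) - x (q k) ∈ T} = volume T ^ m
  | 0, p, q, _, _ => by simp
  | m + 1, p, q, hp, hpq => by
      have hsplit : {x : Fin n → T3 | ∀ k : Fin (m + 1), x (p k) - x (q k) ∈ T}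
          = {x : Fin n → T3 | ∀ k : Fin m, x (p k.succ) - x (q k.succ) ∈ T} ∩
            {x | x (p 0) - x (q 0) ∈ T} := by
        ext x
        simp only [Set.mem_setOf_eq, Set.mem_inter_iff]
        constructor
        · intro h
          exact ⟨fun k => h k.succ, h 0⟩
        · rintro ⟨h1, h0⟩ k
          induction k using Fin.cases with
          | zero => exact h0
          | succ k => exact h1 k
      have hSa : ∀ (x : Fin n → T3) (y : T3),
          Function.update x (p 0) y ∈ {x : Fin n → T3 | ∀ k : Fin m, x (p k.succ) - x (q k.succ) ∈ T}
            ↔ x ∈ {x : Fin n → T3 | ∀ k : Fin m, x (p k.succ) - x (q k.succ) ∈ T} := by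
        intro x y
        have hne1 : ∀ k : Fin m, p k.succ ≠ p 0 := fun k h => Fin.succ_ne_zero k (hp h)
        have hne2 : ∀ k : Fin m, q k.succ ≠ p 0 := fun k h => hpq 0 k.succ h.symm
        simp only [Set.mem_setOf_eq, Function.update_of_ne (hne1 _), Function.update_of_ne (hne2 _)]
      rw [hsplit, TrueAnchoredInfection.pi_inter_pairEvent_eq
          (measurableSet_pairsEvent (fun k => p k.succ) (fun k => q k.succ) hT) (hpq 0 0) hSa hT,
        pi_pairsEvent_eq hT (fun k => p k.succ) (fun k => q k.succ) (hp.comp (Fin.succ_injective _))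
          (fun k k' => hpq _ _), pow_succ]

open Literature.MathematicalPhysics.KineticTheory in
/-- **Disjoint close pairs are exponentially unlikely.** Under `G_N` (constant profiles, `0 < σ ≤ 1/4`), for `m`
pairs `(p k, q k)` of spheres with all `2m` indices distinct and a relative shell width `0 < lam ≤ 1`, the
probability that every pair is within minimal-image distance `ε_N(1 + lam)` is at most `(200 σ³ lam / (N+1))^m`
(the hard core forces each pair distance into the thin shell `[ε_N, ε_N(1+lam)]`, an event depending on `2m`
coordinates, of `pi`-volume `(vol shell)^m ≤ (v₁((1+lam)³ − 1)ε_N³)^m`; the hard-core marginal (Ruelle) bound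
`posGibbsMeasure_marginal_le` charges a factor `2` per coordinate; `(N+1)ε_N³ = σ³`, `v₁ = 4π/3 ≤ 16/3`). [folklore] -/
theorem snp_pairsBound :
    ∀ (a θ : ℝ) (u₀ : V3) (ha : 0 < a) (hθ : 0 < θ) (σ : ℝ) (hσ : 0 < σ) (hσ4 : σ ≤ 1 / 4)
    (N : ℕ) (Φ : HardSphereFlow (Torus.geometry (Fin 3)) (hsDiameter σ N) (N + 1))
    (m : ℕ) (p q : Fin m → Fin (N + 1)) (hp : Function.Injective p) (hq : Function.Injective q)
    (hpq : ∀ k k', p k ≠ q k') (lam : ℝ) (hlam : 0 < lam) (hlam1 : lam ≤ 1),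
    localGibbsLaw σ (fun _ => a) (fun _ => u₀) (fun _ => θ) N Φ
        {z | ∀ k, Torus.euclidDist (z (p k)).1 (z (q k)).1 ≤ hsDiameter σ N * (1 + lam)} ≤
      ENNReal.ofReal ((200 * σ ^ 3 * lam / (N + 1)) ^ m) := by
  intro a θ u₀ ha hθ σ hσ hσ4 N Φ m p q hp hq hpq lam hlam hlam1
  -- the case `m = 0`: a probability is at most `1 = x ^ 0`
  rcases Nat.eq_zero_or_pos m with rfl | hm
  · haveI := isProbabilityMeasure_localGibbsLaw (a₀ := fun _ => a) (θ₀ := fun _ => θ) (u₀ := fun _ => u₀)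
      continuous_const continuous_const continuous_const (fun _ => ha) (fun _ => hθ)
      (show σ ≤ 1 / 2 by linarith) N Φ
    rw [pow_zero, ENNReal.ofReal_one]
    exact prob_le_one
  -- now `m ≥ 1`, hence `N ≥ 1` (two distinct labels `p k₀ ≠ q k₀`), hence `ε_N < σ ≤ 1/4`
  set ε := hsDiameter σ N with hε_def
  have hN : N ≠ 0 := by
    rintro rfl
    have h1 := (p ⟨0, hm⟩).isLt
    have h2 := (q ⟨0, hm⟩).isLt
    exact hpq ⟨0, hm⟩ ⟨0, hm⟩ (Fin.ext (by omega))
  have hε0 : 0 < ε := hsDiameter_pos hσ N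
  have hεσ : ε < σ := by
    rw [hε_def, hsDiameter]
    refine mul_lt_of_lt_one_right hσ (Real.rpow_lt_one_of_one_lt_of_neg ?_ (by norm_num))
    exact_mod_cast (show 1 < N + 1 by omega)
  set r := ε * (1 + lam) with hr_def
  have hr : r < 1 / 2 := by rw [hr_def]; nlinarith
  -- Step 1: the event is a position event; its law is the configurational Gibbs measure
  set S : Set (Fin (N + 1) → T3) := {x | ∀ k, Torus.euclidDist (x (p k)) (x (q k)) ≤ r} with hS_def
  have hS : MeasurableSet S := by
    rw [hS_def, Set.setOf_forall]
    exact MeasurableSet.iInter fun k =>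
      measurableSet_le (continuous_euclidDist_apply _ _).measurable measurable_const
  have hevent : {z : Config (N + 1) (Fin 3) T3 | ∀ k, Torus.euclidDist (z (p k)).1 (z (q k)).1 ≤ r}
      = (fun (z : Config (N + 1) (Fin 3) T3) (i : Fin (N + 1)) => (z i).1) ⁻¹' S := rfl
  rw [hevent, localGibbsLaw_eq, localGibbsMeasure_preimage_pos continuous_const continuous_const
      continuous_const (fun _ => ha.le) (fun _ => hθ) σ N hS]
  -- Step 2: almost surely the hard core holds, so every pair displacement lies in the thin shell `T`
  set T : Set T3 := {u | ε ≤ Torus.euclidDist u 0 ∧ Torus.euclidDist u 0 ≤ r} with hT_def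
  have hT : MeasurableSet T := TrueAnchoredInfection.measurableSet_shell ε r
  set S' : Set (Fin (N + 1) → T3) := {x | ∀ k, x (p k) - x (q k) ∈ T} with hS'_def
  have hS' : MeasurableSet S' := measurableSet_pairsEvent p q hT
  have hsub : S ∩ posDomain ε (N + 1) ⊆ S' := by
    rintro x ⟨hxS, hxD⟩ k
    have hd : Torus.euclidDist (x (p k) - x (q k)) 0 = Torus.euclidDist (x (p k)) (x (q k)) := by
      rw [Torus.euclidDist, Torus.euclidDist, sub_zero]
    refine ⟨?_, ?_⟩
    · rw [hd]; exact hxD _ _ (hpq k k)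
    · rw [hd]; exact hxS k
  have h2 : posGibbsMeasure (fun _ : T3 => a) ε (N + 1) S ≤ posGibbsMeasure (fun _ : T3 => a) ε (N + 1) S' := by
    rw [← posGibbsMeasure_inter_posDomain]
    exact measure_mono hsub
  -- Step 3: the shell event depends on the `≤ 2m` coordinates of `im p ∪ im q`: hard-core marginal bound
  set I : Finset (Fin (N + 1)) := Finset.univ.image p ∪ Finset.univ.image q with hI_def
  have hI : I.card ≤ 2 * m := by
    calc I.card ≤ (Finset.univ.image p).card + (Finset.univ.image q).card := Finset.card_union_le _ _
      _ = 2 * m := by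
          rw [Finset.card_image_of_injective _ hp, Finset.card_image_of_injective _ hq, Finset.card_univ,
            Fintype.card_fin]
          ring
  have hS'I : ∀ x y : Fin (N + 1) → T3, (∀ i ∈ I, x i = y i) → (x ∈ S' ↔ y ∈ S') := by
    intro x y hxy
    have hp' : ∀ k, x (p k) = y (p k) := fun k =>
      hxy _ (Finset.mem_union_left _ (Finset.mem_image_of_mem p (Finset.mem_univ k)))
    have hq' : ∀ k, x (q k) = y (q k) := fun k =>
      hxy _ (Finset.mem_union_right _ (Finset.mem_image_of_mem q (Finset.mem_univ k)))
    simp only [hS'_def, Set.mem_setOf_eq, hp', hq']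
  have hlamσ : v₁ * σ ^ 3 ≤ 1 / 2 := by
    have hσ3 : σ ^ 3 ≤ (1 / 4) ^ 3 := pow_le_pow_left₀ hσ.le hσ4 3
    nlinarith [v₁_pos, v₁_le]
  have h3 : posGibbsMeasure (fun _ : T3 => a) ε (N + 1) S' ≤ 2 ^ I.card * volume S' :=
    posGibbsMeasure_marginal_le ha hσ (by linarith) hlamσ N I hS' hS'I
  -- Step 4: product volume of the shell event, Step 5: volume of the shell
  have h4 : volume S' = volume T ^ m := pi_pairsEvent_eq hT p q hp hpq
  have h5 : volume T ≤ ENNReal.ofReal (v₁ * (r ^ 3 - ε ^ 3)) :=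
    TrueAnchoredInfection.volume_shell_le hε0.le hr
  -- Step 6: arithmetic
  have hε3 : ε ^ 3 = σ ^ 3 / (N + 1 : ℕ) := hsDiameter_pow_three σ N
  have hcube : r ^ 3 - ε ^ 3 = ε ^ 3 * ((1 + lam) ^ 3 - 1) := by rw [hr_def]; ring
  have hl0 : 0 ≤ (1 + lam) ^ 3 - 1 := sub_nonneg.2 (one_le_pow₀ (by linarith))
  have h7 : (1 + lam) ^ 3 - 1 ≤ 7 * lam := by
    have hl2 : lam ^ 2 ≤ lam := by nlinarith
    have hl3 : lam ^ 3 ≤ lam := by nlinarith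
    nlinarith
  have hnonneg : 0 ≤ v₁ * (r ^ 3 - ε ^ 3) := by
    rw [hcube]
    exact mul_nonneg v₁_pos.le (mul_nonneg (pow_nonneg hε0.le 3) hl0)
  have haux : ∀ x : ℝ, 0 ≤ x → (2 : ℝ≥0∞) ^ (2 * m) * ENNReal.ofReal x ^ m = ENNReal.ofReal ((4 * x) ^ m) := by
    intro x hx
    rw [mul_pow, ENNReal.ofReal_mul (by positivity), ENNReal.ofReal_pow hx, ENNReal.ofReal_pow (by norm_num),
      pow_mul, ENNReal.ofReal_ofNat]
    norm_num
  have hN1 : (0 : ℝ) < N + 1 := by positivity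
  have hkey : 4 * (v₁ * (r ^ 3 - ε ^ 3)) ≤ 200 * σ ^ 3 * lam / (N + 1) := by
    rw [hcube, hε3, le_div_iff₀ hN1]
    push_cast
    have hx : 4 * (v₁ * (σ ^ 3 / (N + 1) * ((1 + lam) ^ 3 - 1))) * (N + 1)
        = 4 * v₁ * σ ^ 3 * ((1 + lam) ^ 3 - 1) := by
      field_simp
    rw [hx]
    have hσ3 : 0 < σ ^ 3 := pow_pos hσ 3
    calc 4 * v₁ * σ ^ 3 * ((1 + lam) ^ 3 - 1) ≤ 4 * (16 / 3) * σ ^ 3 * (7 * lam) := by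
          gcongr
          · exact v₁_le
      _ ≤ 200 * σ ^ 3 * lam := by nlinarith
  calc posGibbsMeasure (fun _ : T3 => a) ε (N + 1) S
      ≤ posGibbsMeasure (fun _ : T3 => a) ε (N + 1) S' := h2
    _ ≤ 2 ^ I.card * volume S' := h3
    _ ≤ 2 ^ (2 * m) * ENNReal.ofReal (v₁ * (r ^ 3 - ε ^ 3)) ^ m := by
        rw [h4]
        gcongr
        · exact one_le_two
    _ = ENNReal.ofReal ((4 * (v₁ * (r ^ 3 - ε ^ 3))) ^ m) := haux _ hnonneg
    _ ≤ ENNReal.ofReal ((200 * σ ^ 3 * lam / (N + 1)) ^ m) :=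
        ENNReal.ofReal_le_ofReal (pow_le_pow_left₀ (by positivity) hkey m)

end Summit.AtomisticToContinuum.HydrodynamicLimit.Theorems.ShotNoisePressure

end
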